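/-
Copyright: public-domain mathematics; typed transcription for the H21 Literature library (cell lit-balaban,
Phase-2 proof seat p38 gen 6 = literature-prover-lit-balaban-p38-g6-0; design memo (d) of the B5 fold owner r02).

statement-level skeleton of published theorems with citation tags; proofs where landed; nothing here is a claim about the Yang–Mills mass gap

# Bałaban, *Propagators and renormalization transformations for lattice gauge theories. I*,
# Commun. Math. Phys. **95** (1984) 17–40 — THE IDENTITY (1.132) `G = G₀ + G₀∂P∂*G` ENTRYWISE ACROSS THE TWO PRESENTATIONS:
# the located display `B5Transfer133.Display133` of the (1.132)-transfer PROVED for the carrier of record `B5Carrier132Pieces.carrier132`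

[cite: Balaban1984PropagatorsI]  T. Bałaban, Commun. Math. Phys. 95 (1984) 17–40.  p. 39 [PDF 23], verbatim: «This proof, and
also a proof of (1.115)–(1.117), makes use of the identity G = G₀ + G₀∂P∂*G, (1.132) where G₀ = (Δ + aQ*Q)^{−1}. This operator
is similar to G′, but with the different averaging operator. We will prove (1.115)–(1.117), and in fact the whole Proposition
1.2, for the operator G₀. This together with the properties (1.126), (1.127) of ∂P∂* and (1.89), or (1.114) for the operator G
implies immediately (1.115)–(1.117), or Proposition 1.2 for G.»  pp. 35–36 [PDF 19–20]: Proposition 1.2 (1.108)–(1.114).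

WHAT THIS MODULE PROVES (SKELETON row B5.Prop1.2, owner's census (vii)-(1.132), r02 DESIGN-MEMO step (d), second file).
S₀ = the h1-truncated G-setting of record `B5Carrier132Pieces.latticeSettingP12Rt (nP P) (MP P) a P.K` (matrix presentation,
G = Δ_a⁻¹ = (DeltaA)⁻¹, complex entries of real sources), S′ = p37's diagonal G₀-setting `B5G0DiagTorus.g0Diag P a 0 P.K`
(tower presentation), K = `carrier132 P a` (σ, ι, κ = r02's `σR`/`ιR`/`κR`; pieces `1_{Δ(y″)}∂P∂*G^{(p)}J` read on the tower):
* §1 **THE MASTER IDENTITY** `G·(embA A) = embA (G₀A) + Σ_{y″∈T₁} embA (G₀·pc A y″)` for every real tower vector function `A`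
  (`G_embA_eq`): the resolvent identity (1.132) for the matrices of record (`B5Carrier132Pieces.resolvent132`), the realness of
  `G` and `∂P∂*` (`B5RealFields`), the partition of the bonds of `T_η` into the unit cubes (`B5Cube1Partition`), and r02's
  operator dictionary «G₀ agrees in the two typings» (`B5G0BridgeP12Norms.G0_embA'`); its derived forms for `∇G`, `ΔG`
  (`grad_embA`, `embA_Lap`) and the readings `GJ` (vector sources: `A = pullV J`), `G∇*T` (tensor sources: `A = ∇*T` via
  `embA_tDiv`), pointwise at the bridged sites `eFine x`;
* §2 the dictionary between p37's diagonal kernels `dK0/dKD/dKL/dDiv/dDD` and `tG0/tD/tDiv` at the top level (`dEta_top`,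
  `lapEta_top`);
* §3 **`display132 : B5Transfer133.Display133 (carrier132 P a) Dh`** for every `Dh ≥ d + 1`: the four sup clauses (1.110), the
  second-order clauses (1.112)/(1.113) and the Hölder clause (1.111) of the located display, entry by entry — the matrix-side
  norms (r19's `LatticeNorms.supNorm`/`holderSeminormB5` over the cubes `cubeB`/`cubeT`) are bounded through `supNorm_le` /
  `holderSeminorm_le` by the tower-side cube sups and Hölder norms of G₀ applied to `ι J` and to the pieces (subadditivity);
  the one non-identity step — ‖ζ·G₀(piece)‖_α for the tensor kind — is p37's product rule with the lattice mean-value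
  inequality (`B5Display133G0Torus.holN_cut_mul_le`, exponents `α ≤ 1`, the reason for the truncation) over the radius-6 ball
  of cubes around y (`proj_mem_nbrOf`), constant `Dh = d + 1`, exactly as in p37's (1.133)-display.
Together with `B5Carrier132Pieces.mapFacts/pieceFacts/uRow` this discharges EVERY located leaf of r02/b05's
`B5Transfer132.prop12_of_G0_via132` for Bałaban's tori except its three analytic inputs (Prop. 1.2 for G₀ — a theorem,
p38 g5 `prop12Printed_famDiagTop`; (1.126) for the matrix of record; (1.114) for G) — see `B5Prop12GLattice`.

HONEST SCOPE.  Pure bookkeeping over two typings of the same finite torus; no analysis beyond the lattice mean-value inequality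
already in the tree; U = 1; constants explicit, not optimised.  Value = the printed word «immediately» (p. 39) made
kernel-checked arithmetic for Bałaban's own G and G₀ — NOT summit progress.
-/
import Mathlib
import Literature.MathematicalPhysics.QuantumFieldTheory.Balaban1983to89.B5Carrier132Pieces
import Literature.MathematicalPhysics.QuantumFieldTheory.Balaban1983to89.B5Display133G0Torus

open scoped BigOperators Matrix Real ComplexConjugate
open Finset Matrix

namespace Literature.MathematicalPhysics.QuantumFieldTheory.Balaban1983to89.B5Display132Lattice

open Literature.MathematicalPhysics.QuantumFieldTheory.Balaban1983to89
open Literature.MathematicalPhysics.QuantumFieldTheory.Balaban1983to89.B5Prop11Plancherel (Tor fine)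
open Literature.MathematicalPhysics.QuantumFieldTheory.Balaban1983to89.B5Prop11Lower (Lap nsq)
open Literature.MathematicalPhysics.QuantumFieldTheory.Balaban1983to89.B5Prop11Lattice (l2 l2T grad divT)
open Literature.MathematicalPhysics.QuantumFieldTheory.Balaban1983to89.B5Prop11SettingModel (Loc189 locNorm)
open Literature.MathematicalPhysics.QuantumFieldTheory.Balaban1983to89.B5Prop12FieldsLattice (cubeT cube1 cubeB distU distSite
  suppInL supNormL holderL holderV holderT cutInL cutSupL cutHL eL h1L e4L h2L l2locL smulV smulT distU_nonneg distU_self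
  cutHL_nonneg)
open Literature.MathematicalPhysics.QuantumFieldTheory.Balaban1983to89.B5SettingP12Weighted (sqEta)
open Literature.MathematicalPhysics.QuantumFieldTheory.Balaban1983to89.B5SettingP12Real (LocR latticeSettingP12R)
open Literature.MathematicalPhysics.QuantumFieldTheory.Balaban1983to89.B5DeltaA169 (DeltaA)
open Literature.MathematicalPhysics.QuantumFieldTheory.Balaban1983to89.B5RealFields (IsReal reM cplx isReal_DeltaA_inv)
open Literature.MathematicalPhysics.QuantumFieldTheory.Balaban1983to89.B5SiteBridgeP12 (nP MP eFine eUnit one_le_nP distX_K_eq T_K_eq)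
open Literature.MathematicalPhysics.QuantumFieldTheory.Balaban1983to89.B5G0BridgeP12 (embA embA_apply embA_apply_eFine embA_add
  embA_sum embA_Lap tG0 tD tDiv G0_embA' grad_embA embA_tDiv)
open Literature.MathematicalPhysics.QuantumFieldTheory.Balaban1983to89.B5Carrier132Maps (σR κR ιR pullV embA_pullV eUnit_σR dist_σR
  inCube_σR_iff cutHV_κR_le cutIn_κR)
open Literature.MathematicalPhysics.QuantumFieldTheory.Balaban1983to89.B5Carrier132Pieces (latticeSettingP12Rt h1_Rt V isReal_V resolvent132
  indB sum_indB_mul unpullV cplx_unpullV pullV_unpullV unpullV_pullV pc srcOf piece132 zeta0 kd kc carrier132 pc_supp)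
open Literature.MathematicalPhysics.QuantumFieldTheory.Balaban1983to89.B5TowerSourcesG0 (LocT suppInT supNormT l2NormT)
open Literature.MathematicalPhysics.QuantumFieldTheory.Balaban1983to89.B5G0DiagTorus (g0Diag dK0 dKD dKL dDiv dDD holG e3 h13 e43
  h23 le_holG holG_nonneg)
open Literature.MathematicalPhysics.QuantumFieldTheory.Balaban1983to89.B5G0SettingTorus (dEta lapEta dEta_top lapEta_top opK0 opKD
  opK1 opKL opKDD opDiv opDD)
open Literature.MathematicalPhysics.QuantumFieldTheory.Balaban1983to89.B5GpSettingTorus (inCube cubeSup le_cubeSup cubeSup_nonneg dir0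
  supNormV cutHV cutHV_nonneg)
open Literature.MathematicalPhysics.QuantumFieldTheory.Balaban1983to89.B5Ineq137Torus (T distX supN holN le_supN supN_nonneg holN_nonneg
  distX_nonneg eq_of_distX_eq_zero)
open Literature.MathematicalPhysics.QuantumFieldTheory.Balaban1983to89.B5Display133G0Torus (holN_add_le holN_sum_le holN_cut_mul_le
  proj_mem_nbrOf)
open Literature.MathematicalPhysics.QuantumFieldTheory.Balaban1983to89.B5Pieces133Torus (inCube_proj)
open Literature.MathematicalPhysics.QuantumFieldTheory.Balaban1983to89.B1RG242Torus (deriv hOp H)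
open Literature.MathematicalPhysics.QuantumFieldTheory.Balaban1983to89.LatticeNorms (supNorm supNorm_nonneg norm_le_supNorm supNorm_le
  holderSeminormB5 holderSeminorm_le holderSeminorm_nonneg)

noncomputable section

variable (P : Params) {a : ℝ}

/-! ## §1 The master identity: `GJ`, `∇GJ`, `ΔGJ`, `G∇*T` on the matrix side through G₀ and the pieces on the tower -/

section Master

variable (ha : 0 < a)
include ha

/-- **THE IDENTITY (1.132) AT A REAL SOURCE, ACROSS THE TWO PRESENTATIONS**: for a real tower vector function `A`,
`G·(embA A) = embA (G₀A) + Σ_{y″} embA (G₀·(1_{Δ(y″)}∂P∂*GA))` — `G = Δ_a⁻¹`, `G₀ = (Δ + aQ*Q)⁻¹` in r02's matrix presentation,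
`G₀ = ⊕_μ G₀^{(μ)}` in p37's tower presentation (`tG0`), the pieces `B5Carrier132Pieces.pc`.
[cite: Balaban1984PropagatorsI, (1.132) p.39] -/
theorem G_embA_eq (A : Fin P.d → Site P 0 → ℝ) :
    (DeltaA (nP P) (MP P) a)⁻¹ *ᵥ embA P A
      = embA P (tG0 P a A) + ∑ y'' : Tor (MP P), embA P (tG0 P a (pc P a A y'')) := by
  have hn : 1 ≤ nP P := one_le_nP P
  -- the real bond function W = re(∂P∂*·G)·A♭ and its cube decomposition
  set W : Tor (fine (nP P) (MP P)) × Fin P.d → ℝ :=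
    reM (V (nP P) (MP P) * (DeltaA (nP P) (MP P) a)⁻¹) *ᵥ unpullV P A with hW
  have hVG : (V (nP P) (MP P) * (DeltaA (nP P) (MP P) a)⁻¹) *ᵥ embA P A = cplx W := by
    rw [← cplx_unpullV, ← ((isReal_V (nP P) (MP P)).mul (isReal_DeltaA_inv (nP P) (MP P) a)).cplx_mulVec]
  have hdec : cplx W = ∑ y'' : Tor (MP P), embA P (pc P a A y'') := by
    have hpc : ∀ y'', embA P (pc P a A y'') = cplx (fun b => indB (nP P) (MP P) y'' b * W b) := fun y'' => by
      rw [pc, embA_pullV]; rfl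
    simp only [hpc, ← B5RealFields.cplx_sum]
    congr 1
    funext b
    rw [Finset.sum_apply]
    exact (sum_indB_mul b (W b)).symm
  calc (DeltaA (nP P) (MP P) a)⁻¹ *ᵥ embA P A
      = (B5Prop11G0Torus.G0 (nP P) (MP P) a + B5Prop11G0Torus.G0 (nP P) (MP P) a * V (nP P) (MP P) *
          (DeltaA (nP P) (MP P) a)⁻¹) *ᵥ embA P A := by rw [← resolvent132 (MP P) hn ha]
    _ = B5Prop11G0Torus.G0 (nP P) (MP P) a *ᵥ embA P A +
          B5Prop11G0Torus.G0 (nP P) (MP P) a *ᵥ ((V (nP P) (MP P) * (DeltaA (nP P) (MP P) a)⁻¹) *ᵥ embA P A) := by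
        rw [Matrix.add_mulVec, Matrix.mul_assoc, ← Matrix.mulVec_mulVec]
    _ = embA P (tG0 P a A) + ∑ y'' : Tor (MP P), embA P (tG0 P a (pc P a A y'')) := by
        rw [G0_embA' P ha, hVG, hdec, Matrix.mulVec_sum]
        congr 1
        exact Finset.sum_congr rfl fun y'' _ => G0_embA' P ha _

/-- the same as ONE tower vector function: `G·(embA A) = embA (G₀A + Σ_{y″} G₀·pc A y″)`. [cite: Balaban1984PropagatorsI, (1.132) p.39] -/
theorem G_embA_eq' (A : Fin P.d → Site P 0 → ℝ) :
    (DeltaA (nP P) (MP P) a)⁻¹ *ᵥ embA P A = embA P (tG0 P a A + ∑ y'' : Tor (MP P), tG0 P a (pc P a A y'')) := by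
  rw [embA_add, embA_sum, G_embA_eq P ha]

/-- **`(GA)_μ(x)` pointwise** at a bridged site: `(G·embA A)(eFine x, μ) = (G₀A)_μ(x) + Σ_{y″} (G₀·pc A y″)_μ(x)` (a real number).
[cite: Balaban1984PropagatorsI, (1.132) p.39, (1.110) p.35] -/
theorem G_embA_apply (A : Fin P.d → Site P 0 → ℝ) (x : Site P 0) (μ : Fin P.d) :
    ((DeltaA (nP P) (MP P) a)⁻¹ *ᵥ embA P A) (eFine P x, μ)
      = ((tG0 P a A μ x + ∑ y'' : Tor (MP P), tG0 P a (pc P a A y'') μ x : ℝ) : ℂ) := by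
  rw [G_embA_eq' P ha, embA_apply_eFine]
  simp [Finset.sum_apply]

/-- **`(∇GA)_{λμ}(x)` pointwise**: `∇_λ(G·embA A)(eFine x, μ) = (∂_λG₀A)_μ(x) + Σ_{y″} (∂_λG₀·pc A y″)_μ(x)`.
[cite: Balaban1984PropagatorsI, (1.132) p.39, (1.110) p.35] -/
theorem grad_G_embA_apply (A : Fin P.d → Site P 0 → ℝ) (lam : Fin P.d) (x : Site P 0) (μ : Fin P.d) :
    grad (nP P) (MP P) ((DeltaA (nP P) (MP P) a)⁻¹ *ᵥ embA P A) lam (eFine P x, μ)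
      = ((tD P lam (tG0 P a A) μ x + ∑ y'' : Tor (MP P), tD P lam (tG0 P a (pc P a A y'')) μ x : ℝ) : ℂ) := by
  rw [G_embA_eq' P ha, grad_embA, embA_apply_eFine]
  simp [tD, Finset.sum_apply, Matrix.mulVec_add, Matrix.mulVec_sum]

/-- **`(ΔGA)_μ(x)` pointwise**: `Δ(G·embA A)(eFine x, μ) = (ΔG₀A)_μ(x) + Σ_{y″} (ΔG₀·pc A y″)_μ(x)`, Δ = the tower's `hOp P 0 ε 0`.
[cite: Balaban1984PropagatorsI, (1.132) p.39, (1.110) p.35] -/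
theorem Lap_G_embA_apply (A : Fin P.d → Site P 0 → ℝ) (x : Site P 0) (μ : Fin P.d) :
    (Lap (nP P) (MP P) *ᵥ ((DeltaA (nP P) (MP P) a)⁻¹ *ᵥ embA P A)) (eFine P x, μ)
      = (((hOp P 0 P.eps 0 *ᵥ tG0 P a A μ) x + ∑ y'' : Tor (MP P), (hOp P 0 P.eps 0 *ᵥ tG0 P a (pc P a A y'') μ) x : ℝ) : ℂ) := by
  rw [G_embA_eq' P ha, embA_Lap, embA_apply_eFine]
  simp [Finset.sum_apply, Matrix.mulVec_add, Matrix.mulVec_sum]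

omit ha in
/-- a real vector source on the matrix side is `embA` of its pull-back: `(J : ℂ) = embA (pullV J)`.
[cite: Balaban1984PropagatorsI, (1.18) p.20] -/
theorem cplxVec_eq_embA (J : Tor (fine (nP P) (MP P)) × Fin P.d → ℝ) : (fun b => (J b : ℂ)) = embA P (pullV P J) :=
  (embA_pullV P J).symm

omit ha in
/-- a real tensor source's divergence on the matrix side is `embA (∇*T)` of the pull-backs (r02's `embA_tDiv`).
[cite: Balaban1984PropagatorsI, (1.89) p.33] -/
theorem divT_cplx_eq_embA (Tt : Fin P.d → Tor (fine (nP P) (MP P)) × Fin P.d → ℝ) :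
    divT (nP P) (MP P) (fun ν b => (Tt ν b : ℂ)) = embA P (tDiv P (fun ν => pullV P (Tt ν))) := by
  rw [embA_tDiv]
  congr 1
  funext ν
  exact (embA_pullV P (Tt ν)).symm

end Master

/-! ## §2 p37's diagonal kernels at the top level in the `tG0/tD/tDiv` vocabulary -/

section Dictionary

/-- `(G₀A)_μ(x) = (G₀^{(μ)}A_μ)(x)`. [cite: Balaban1984PropagatorsI, (1.132) p.39] -/
theorem dK0_eq (A : Fin P.d → Site P 0 → ℝ) (μ : Fin P.d) (x : Site P 0) : dK0 P a 0 P.K A μ x = tG0 P a A μ x := rfl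

/-- `(∇G₀A)_{λμ}(x) = (∂_λ(G₀A)_μ)(x)` at the top level (`∂^η = ∂^ε`). [cite: Balaban1984PropagatorsI, (1.110) p.35] -/
theorem dKD_eq (A : Fin P.d → Site P 0 → ℝ) (lam μ : Fin P.d) (x : Site P 0) :
    dKD P a 0 P.K A (lam, μ) x = tD P lam (tG0 P a A) μ x := by
  rw [dKD, opKD, dEta_top, tD, tG0, Matrix.mulVec_mulVec]

/-- `(ΔG₀A)_μ(x) = (Δ(G₀A)_μ)(x)`, Δ = `hOp P 0 ε 0` at the top level. [cite: Balaban1984PropagatorsI, (1.110) p.35] -/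
theorem dKL_eq (A : Fin P.d → Site P 0 → ℝ) (μ : Fin P.d) (x : Site P 0) :
    dKL P a 0 P.K A μ x = (hOp P 0 P.eps 0 *ᵥ tG0 P a A μ) x := by
  rw [dKL, opKL, lapEta_top, H, tG0, Matrix.mulVec_mulVec]

/-- `(G₀∇*T)_μ(x) = (G₀(∇*T))_μ(x)` with r02's `tDiv`, at the top level. [cite: Balaban1984PropagatorsI, (1.110) p.35] -/
theorem dDiv_eq (Tt : Fin P.d → Fin P.d → Site P 0 → ℝ) (μ : Fin P.d) (x : Site P 0) :
    dDiv P a 0 P.K Tt μ x = tG0 P a (tDiv P Tt) μ x := by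
  have h : tDiv P Tt μ = ∑ ν, (deriv P 0 P.eps ν)ᵀ *ᵥ Tt ν μ := by
    rw [tDiv, Finset.sum_apply]
  rw [dDiv, opDiv, tG0, h, Matrix.mulVec_sum, Finset.sum_apply]
  refine Finset.sum_congr rfl fun ν _ => ?_
  rw [opK1, dEta_top]
  show ((B5Eq133G0Torus.G0 P a 0 P.K μ * (deriv P 0 P.eps ν)ᵀ) *ᵥ Tt ν μ) x = _
  rw [Matrix.mulVec_mulVec]

/-- `(∇G₀∇*T)_{λμ}(x) = (∂_λ(G₀∇*T)_μ)(x)` at the top level. [cite: Balaban1984PropagatorsI, (1.112) p.36] -/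
theorem dDD_eq (Tt : Fin P.d → Fin P.d → Site P 0 → ℝ) (lam μ : Fin P.d) (x : Site P 0) :
    dDD P a 0 P.K Tt (lam, μ) x = tD P lam (tG0 P a (tDiv P Tt)) μ x := by
  have h : tDiv P Tt μ = ∑ ν, (deriv P 0 P.eps ν)ᵀ *ᵥ Tt ν μ := by
    rw [tDiv, Finset.sum_apply]
  rw [dDD, opDD, tD, tG0, h, Matrix.mulVec_sum, Matrix.mulVec_sum, Finset.sum_apply]
  refine Finset.sum_congr rfl fun ν _ => ?_
  rw [opKDD, dEta_top, dEta_top]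
  show ((deriv P 0 P.eps lam * B5Eq133G0Torus.G0 P a 0 P.K μ * (deriv P 0 P.eps ν)ᵀ) *ᵥ Tt ν μ) x = _
  rw [Matrix.mulVec_mulVec, Matrix.mulVec_mulVec, Matrix.mul_assoc]

end Dictionary

/-! ## §3 The located display `B5Transfer133.Display133` of the (1.132)-transfer, PROVED -/

section Display

/-! ### geometric and norm dictionaries used by every clause -/

/-- `σ (eUnit s) = s`. [cite: Balaban1984PropagatorsI, p.35 (T₁^{(k)})] -/
@[simp] theorem σR_eUnit (s : Site P P.K) : σR P (eUnit P s) = s := (eUnit P).symm_apply_apply s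

/-- a unit site of the tower within 6 of `σ y` names a point of the radius-6 ball of `y` on the G side.
[cite: Balaban1984PropagatorsI, p.35 (the cubes Δ̃(y))] -/
theorem eUnit_mem_ball {y : Tor (MP P)} {s : Site P P.K} (hs : s ∈ B5TorusCover.nbrOf (T P P.K) 6 (σR P y)) :
    eUnit P s ∈ B5UnitBallCard.ball (MP P) y 6 := by
  rw [B5TorusCover.nbrOf, Finset.mem_filter] at hs
  have h := hs.2
  rw [T_K_eq, eUnit_σR] at h
  rw [B5UnitBallCard.mem_ball]
  exact_mod_cast h

/-- **r19's sup norm over the bonds of `Δ̃(y)` through the tower**: `sup_{b ∈ cubeB y} ‖F b‖ ≤ c` as soon as `‖F (eFine x, μ)‖ ≤ c`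
for every tower site `x ∈ Δ̃(σ y)` (`c ≥ 0`). [cite: Balaban1984PropagatorsI, (1.110) p.35 («for x ∈ Δ̃(y)»)] -/
theorem supNorm_cubeB_le {y : Tor (MP P)} (F : Tor (fine (nP P) (MP P)) × Fin P.d → ℂ) {c : ℝ} (hc : 0 ≤ c)
    (h : ∀ (x : Site P 0) (μ : Fin P.d), inCube P P.K x (σR P y) → ‖F (eFine P x, μ)‖ ≤ c) :
    supNorm (cubeB (nP P) (MP P) y) F ≤ c := by
  refine supNorm_le hc fun b hb => ?_
  obtain ⟨z, μ⟩ := b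
  obtain ⟨x, rfl⟩ := (eFine P).surjective z
  simp only [cubeB, Finset.mem_product, Finset.mem_univ, and_true] at hb
  exact h x μ ((inCube_σR_iff P x y).2 hb)

/-- the same for the gradient entries, indexed by `(λ, b)`, `b ∈ cubeB y`. [cite: Balaban1984PropagatorsI, (1.110) p.35] -/
theorem supNorm_gradB_le {y : Tor (MP P)} (F : Fin P.d → Tor (fine (nP P) (MP P)) × Fin P.d → ℂ) {c : ℝ} (hc : 0 ≤ c)
    (h : ∀ (lam : Fin P.d) (x : Site P 0) (μ : Fin P.d), inCube P P.K x (σR P y) → ‖F lam (eFine P x, μ)‖ ≤ c) :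
    supNorm (Finset.univ ×ˢ cubeB (nP P) (MP P) y)
      (fun p : Fin P.d × (Tor (fine (nP P) (MP P)) × Fin P.d) => F p.1 p.2) ≤ c := by
  refine supNorm_le hc fun p hp => ?_
  obtain ⟨lam, z, μ⟩ := p
  obtain ⟨x, rfl⟩ := (eFine P).surjective z
  simp only [cubeB, Finset.mem_product, Finset.mem_univ, and_true, true_and] at hp
  exact h lam x μ ((inCube_σR_iff P x y).2 hp)

/-- **r19's Hölder seminorm (1.109) of a `d`-tensor bond field through the tower**: `‖F‖_α ≤ C` (`C ≥ 0`) as soon as every pair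
of bridged sites `x ≠ x′`, `|x − x′| ≤ 1` (same tensor and vector index) obeys the Hölder bound with constant `C` in the tower's
distance `distX P K` (= r19's `distU`, `distX_K_eq`). [cite: Balaban1984PropagatorsI, (1.109) p.35] -/
theorem holderT_le_of_pairs {α : ℝ} (F : Fin P.d → Tor (fine (nP P) (MP P)) × Fin P.d → ℂ) {C : ℝ} (hC : 0 ≤ C)
    (h : ∀ (lam μ : Fin P.d) (x x' : Site P 0), x ≠ x' → distX P P.K x x' ≤ 1 →
      ‖F lam (eFine P x', μ) - F lam (eFine P x, μ)‖ ≤ C * distX P P.K x x' ^ α) :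
    holderT (nP P) (MP P) α F ≤ C := by
  unfold holderT holderSeminormB5
  refine holderSeminorm_le hC fun p _ p' _ hadm hpos => ?_
  obtain ⟨lam, z, μ⟩ := p
  obtain ⟨lam', z', μ'⟩ := p'
  obtain ⟨⟨hl, hm⟩, hd⟩ := hadm
  dsimp only at hl hm hd hpos
  subst hl hm
  obtain ⟨x, rfl⟩ := (eFine P).surjective z
  obtain ⟨x', rfl⟩ := (eFine P).surjective z'
  have hne : x ≠ x' := by
    rintro rfl
    rw [distU_self] at hpos
    exact lt_irrefl _ hpos
  rw [← distX_K_eq] at hd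
  show ‖F _ (eFine P x', _) - F _ (eFine P x, _)‖ ≤ C * distU (nP P) (MP P) (eFine P x) (eFine P x') ^ α
  rw [← distX_K_eq]
  exact h _ _ x x' hne hd

/-- the same for r19's Hölder seminorm of a vector bond field (same vector index). [cite: Balaban1984PropagatorsI, (1.109) p.35] -/
theorem holderV_le_of_pairs {α : ℝ} (F : Tor (fine (nP P) (MP P)) × Fin P.d → ℂ) {C : ℝ} (hC : 0 ≤ C)
    (h : ∀ (μ : Fin P.d) (x x' : Site P 0), x ≠ x' → distX P P.K x x' ≤ 1 →
      ‖F (eFine P x', μ) - F (eFine P x, μ)‖ ≤ C * distX P P.K x x' ^ α) :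
    holderV (nP P) (MP P) α F ≤ C := by
  unfold holderV holderSeminormB5
  refine holderSeminorm_le hC fun b _ b' _ hadm hpos => ?_
  obtain ⟨z, μ⟩ := b
  obtain ⟨z', μ'⟩ := b'
  obtain ⟨hm, hd⟩ := hadm
  dsimp only at hm hd hpos
  subst hm
  obtain ⟨x, rfl⟩ := (eFine P).surjective z
  obtain ⟨x', rfl⟩ := (eFine P).surjective z'
  have hne : x ≠ x' := by
    rintro rfl
    rw [distU_self] at hpos
    exact lt_irrefl _ hpos
  rw [← distX_K_eq] at hd
  show ‖F (eFine P x', _) - F (eFine P x, _)‖ ≤ C * distU (nP P) (MP P) (eFine P x) (eFine P x') ^ α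
  rw [← distX_K_eq]
  exact h _ x x' hne hd

/-! ### signs of the diagonal G₀-setting's entries -/

/-- the (1.110) entries of `g0Diag` are non-negative. [cite: Balaban1984PropagatorsI, (1.110) p.35] -/
theorem e_diag_nonneg (m : Fin 4) (J : LocT P) (y' : Site P P.K) : 0 ≤ (g0Diag P a 0 P.K).e m J y' := by
  show 0 ≤ e3 P a 0 P.K m J y'
  cases J with
  | vec A => fin_cases m <;> first | exact le_rfl | exact cubeSup_nonneg _ (dir0 P) _ | exact cubeSup_nonneg _ (dir0 P, dir0 P) _
  | ten T => fin_cases m <;> first | exact le_rfl | exact cubeSup_nonneg _ (dir0 P) _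
  | ten2 T => exact le_rfl

/-- the (1.111) entries of `g0Diag` are non-negative. [cite: Balaban1984PropagatorsI, (1.111) p.35] -/
theorem h1_diag_nonneg (J : LocT P) (α : ℝ) (ζ' : Site P 0 → ℝ) : 0 ≤ (g0Diag P a 0 P.K).h1 J α ζ' := by
  show 0 ≤ h13 P a 0 P.K J α ζ'
  cases J with
  | vec A => exact holG_nonneg _ _ (dir0 P, dir0 P) _
  | ten T => exact holG_nonneg _ _ (dir0 P) _
  | ten2 T => exact le_rfl

/-- the (1.112) entries of `g0Diag` are non-negative. [cite: Balaban1984PropagatorsI, (1.112) p.36] -/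
theorem e4_diag_nonneg (J : LocT P) (y' : Site P P.K) : 0 ≤ (g0Diag P a 0 P.K).e4 J y' := by
  show 0 ≤ e43 P a 0 P.K J y'
  cases J with
  | vec A => exact le_rfl
  | ten T => exact cubeSup_nonneg _ (dir0 P, dir0 P) _
  | ten2 T => exact le_rfl

/-- the (1.113) entries of `g0Diag` are non-negative. [cite: Balaban1984PropagatorsI, (1.113) p.36] -/
theorem h2_diag_nonneg (J : LocT P) (α : ℝ) (ζ' : Site P 0 → ℝ) : 0 ≤ (g0Diag P a 0 P.K).h2 J α ζ' := by
  show 0 ≤ h23 P a 0 P.K J α ζ'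
  cases J with
  | vec A => exact le_rfl
  | ten T => exact holG_nonneg _ _ (dir0 P, dir0 P) _
  | ten2 T => exact le_rfl

/-! ### the four clauses -/

/-- **`Display133.sup`: (1.132) for the four sup entries (1.110)** — `|GJ|`, `|∇GJ|`, `|ΔGJ|` (vector sources) and `|G∇*T|`
(tensor sources) over `Δ̃(y)` are ≤ the same entry of G₀ at `ι J` plus the sum over `y″` of the G₀-entries at the pieces
(`G_embA_apply`, `grad_G_embA_apply`, `Lap_G_embA_apply` and subadditivity of the cube sups); the kinds without an entry are `0 ≤ …`.
[cite: Balaban1984PropagatorsI, (1.132) p.39, (1.110) p.35] -/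
theorem sup132 (ha : 0 < a) (n : Fin 4) (J : LocR (nP P) (MP P)) (y : Tor (MP P)) :
    (latticeSettingP12Rt (nP P) (MP P) a P.K).e n J y ≤
      (g0Diag P a 0 P.K).e n (ιR P J) (σR P y) +
        ∑ y'' : Tor (MP P), (g0Diag P a 0 P.K).e (B5Transfer133.mIdx n)
          (piece132 P a (B5Transfer133.pIdx n) J y'') (σR P y) := by
  have h0 : ∀ (n' m : Fin 4) (J' : LocT P) (pcs : Tor (MP P) → LocT P),
      0 ≤ (g0Diag P a 0 P.K).e n' J' (σR P y) + ∑ y'' : Tor (MP P), (g0Diag P a 0 P.K).e m (pcs y'') (σR P y) :=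
    fun n' m J' pcs => add_nonneg (e_diag_nonneg P n' J' _)
      (Finset.sum_nonneg fun y'' _ => e_diag_nonneg P m (pcs y'') _)
  have hc : ∀ {ι : Type} [Fintype ι] (i₀ : ι) (g : Fin P.d → Site P 0 → ℝ) (g' : Tor (MP P) → ι → Site P 0 → ℝ)
      (g₀ : ι → Site P 0 → ℝ), 0 ≤ cubeSup P P.K (σR P y) i₀ g₀ + ∑ y'' : Tor (MP P), cubeSup P P.K (σR P y) i₀ (g' y'') :=
    fun i₀ _ g' g₀ => add_nonneg (cubeSup_nonneg _ _ _) (Finset.sum_nonneg fun _ _ => cubeSup_nonneg _ _ _)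
  cases J with
  | ten2 T2 =>
      show (0 : ℝ) ≤ _
      exact h0 _ _ _ _
  | vec Jv =>
      fin_cases n
      · -- |GJ| over Δ̃(y)
        show supNorm (cubeB (nP P) (MP P) y) ((DeltaA (nP P) (MP P) a)⁻¹ *ᵥ fun b => ((Jv b : ℝ) : ℂ)) ≤
          cubeSup P P.K (σR P y) (dir0 P) (dK0 P a 0 P.K (pullV P Jv)) +
            ∑ y'' : Tor (MP P), cubeSup P P.K (σR P y) (dir0 P) (dK0 P a 0 P.K (pc P a (pullV P Jv) y''))
        rw [cplxVec_eq_embA P Jv]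
        refine supNorm_cubeB_le P _ (hc (dir0 P) (pullV P Jv) _ _) fun x μ hx => ?_
        rw [G_embA_apply P ha, Complex.norm_real, Real.norm_eq_abs]
        refine (abs_add_le _ _).trans (add_le_add ?_ ((Finset.abs_sum_le_sum_abs _ _).trans
          (Finset.sum_le_sum fun y'' _ => ?_)))
        · exact le_cubeSup (dir0 P) (dK0 P a 0 P.K (pullV P Jv)) μ hx
        · exact le_cubeSup (dir0 P) (dK0 P a 0 P.K (pc P a (pullV P Jv) y'')) μ hx
      · -- |∇GJ| over Δ̃(y)
        show supNorm (Finset.univ ×ˢ cubeB (nP P) (MP P) y)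
            (fun p : Fin P.d × (Tor (fine (nP P) (MP P)) × Fin P.d) =>
              grad (nP P) (MP P) ((DeltaA (nP P) (MP P) a)⁻¹ *ᵥ fun b => ((Jv b : ℝ) : ℂ)) p.1 p.2) ≤
          cubeSup P P.K (σR P y) (dir0 P, dir0 P) (dKD P a 0 P.K (pullV P Jv)) +
            ∑ y'' : Tor (MP P), cubeSup P P.K (σR P y) (dir0 P, dir0 P) (dKD P a 0 P.K (pc P a (pullV P Jv) y''))
        rw [cplxVec_eq_embA P Jv]
        refine supNorm_gradB_le P (grad (nP P) (MP P) ((DeltaA (nP P) (MP P) a)⁻¹ *ᵥ embA P (pullV P Jv)))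
          (hc (dir0 P, dir0 P) (pullV P Jv) _ _) fun lam x μ hx => ?_
        rw [grad_G_embA_apply P ha, Complex.norm_real, Real.norm_eq_abs]
        refine (abs_add_le _ _).trans (add_le_add ?_ ((Finset.abs_sum_le_sum_abs _ _).trans
          (Finset.sum_le_sum fun y'' _ => ?_)))
        · have h := le_cubeSup (dir0 P, dir0 P) (dKD P a 0 P.K (pullV P Jv)) (lam, μ) hx
          rwa [dKD_eq] at h
        · have h := le_cubeSup (dir0 P, dir0 P) (dKD P a 0 P.K (pc P a (pullV P Jv) y'')) (lam, μ) hx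
          rwa [dKD_eq] at h
      · -- no entry of this kind on a vector source
        show (0 : ℝ) ≤ _
        exact h0 _ _ _ _
      · -- |ΔGJ| over Δ̃(y)
        show supNorm (cubeB (nP P) (MP P) y)
            (Lap (nP P) (MP P) *ᵥ ((DeltaA (nP P) (MP P) a)⁻¹ *ᵥ fun b => ((Jv b : ℝ) : ℂ))) ≤
          cubeSup P P.K (σR P y) (dir0 P) (dKL P a 0 P.K (pullV P Jv)) +
            ∑ y'' : Tor (MP P), cubeSup P P.K (σR P y) (dir0 P) (dKL P a 0 P.K (pc P a (pullV P Jv) y''))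
        rw [cplxVec_eq_embA P Jv]
        refine supNorm_cubeB_le P _ (hc (dir0 P) (pullV P Jv) _ _) fun x μ hx => ?_
        rw [Lap_G_embA_apply P ha, Complex.norm_real, Real.norm_eq_abs]
        refine (abs_add_le _ _).trans (add_le_add ?_ ((Finset.abs_sum_le_sum_abs _ _).trans
          (Finset.sum_le_sum fun y'' _ => ?_)))
        · have h := le_cubeSup (dir0 P) (dKL P a 0 P.K (pullV P Jv)) μ hx
          rwa [dKL_eq] at h
        · have h := le_cubeSup (dir0 P) (dKL P a 0 P.K (pc P a (pullV P Jv) y'')) μ hx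
          rwa [dKL_eq] at h
  | ten Tt =>
      fin_cases n
      · show (0 : ℝ) ≤ _
        exact h0 _ _ _ _
      · show (0 : ℝ) ≤ _
        exact h0 _ _ _ _
      · -- |G∇*T| over Δ̃(y)
        show supNorm (cubeB (nP P) (MP P) y)
            ((DeltaA (nP P) (MP P) a)⁻¹ *ᵥ divT (nP P) (MP P) fun ν b => ((Tt ν b : ℝ) : ℂ)) ≤
          cubeSup P P.K (σR P y) (dir0 P) (dDiv P a 0 P.K fun ν => pullV P (Tt ν)) +
            ∑ y'' : Tor (MP P), cubeSup P P.K (σR P y) (dir0 P)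
              (dK0 P a 0 P.K (pc P a (tDiv P fun ν => pullV P (Tt ν)) y''))
        rw [divT_cplx_eq_embA P Tt]
        refine supNorm_cubeB_le P _ (hc (dir0 P) (tDiv P fun ν => pullV P (Tt ν)) _ _) fun x μ hx => ?_
        rw [G_embA_apply P ha, Complex.norm_real, Real.norm_eq_abs]
        refine (abs_add_le _ _).trans (add_le_add ?_ ((Finset.abs_sum_le_sum_abs _ _).trans
          (Finset.sum_le_sum fun y'' _ => ?_)))
        · have h := le_cubeSup (dir0 P) (dDiv P a 0 P.K fun ν => pullV P (Tt ν)) μ hx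
          rwa [dDiv_eq] at h
        · exact le_cubeSup (dir0 P) (dK0 P a 0 P.K (pc P a (tDiv P fun ν => pullV P (Tt ν)) y'')) μ hx
      · show (0 : ℝ) ≤ _
        exact h0 _ _ _ _

/-- **`Display133.e4`: (1.132) for the entry (1.112)** — `|∇G∇*T|` over `Δ̃(y)` ≤ `|∇G₀∇*T|` there plus `Σ_{y″} |∇G₀(piece)|`
(`grad_G_embA_apply` at `A = ∇*T`). [cite: Balaban1984PropagatorsI, (1.132) p.39, (1.112) p.36] -/
theorem e4_132 (ha : 0 < a) (J : LocR (nP P) (MP P)) (y : Tor (MP P)) :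
    (latticeSettingP12Rt (nP P) (MP P) a P.K).e4 J y ≤
      (g0Diag P a 0 P.K).e4 (ιR P J) (σR P y) +
        ∑ y'' : Tor (MP P), (g0Diag P a 0 P.K).e 1 (piece132 P a 2 J y'') (σR P y) := by
  have h0 : 0 ≤ (g0Diag P a 0 P.K).e4 (ιR P J) (σR P y) +
      ∑ y'' : Tor (MP P), (g0Diag P a 0 P.K).e 1 (piece132 P a 2 J y'') (σR P y) :=
    add_nonneg (e4_diag_nonneg P _ _) (Finset.sum_nonneg fun y'' _ => e_diag_nonneg P 1 _ _)
  cases J with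
  | vec Jv =>
      show (0 : ℝ) ≤ _
      exact h0
  | ten2 T2 =>
      show (0 : ℝ) ≤ _
      exact h0
  | ten Tt =>
      show supNorm (Finset.univ ×ˢ cubeB (nP P) (MP P) y)
          (fun p : Fin P.d × (Tor (fine (nP P) (MP P)) × Fin P.d) =>
            grad (nP P) (MP P) ((DeltaA (nP P) (MP P) a)⁻¹ *ᵥ divT (nP P) (MP P) fun ν b => ((Tt ν b : ℝ) : ℂ)) p.1 p.2) ≤
        cubeSup P P.K (σR P y) (dir0 P, dir0 P) (dDD P a 0 P.K fun ν => pullV P (Tt ν)) +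
          ∑ y'' : Tor (MP P), cubeSup P P.K (σR P y) (dir0 P, dir0 P)
            (dKD P a 0 P.K (pc P a (tDiv P fun ν => pullV P (Tt ν)) y''))
      rw [divT_cplx_eq_embA P Tt]
      refine supNorm_gradB_le P
        (grad (nP P) (MP P) ((DeltaA (nP P) (MP P) a)⁻¹ *ᵥ embA P (tDiv P fun ν => pullV P (Tt ν))))
        (add_nonneg (cubeSup_nonneg _ _ _) (Finset.sum_nonneg fun _ _ => cubeSup_nonneg _ _ _)) fun lam x μ hx => ?_
      rw [grad_G_embA_apply P ha, Complex.norm_real, Real.norm_eq_abs]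
      refine (abs_add_le _ _).trans (add_le_add ?_ ((Finset.abs_sum_le_sum_abs _ _).trans
        (Finset.sum_le_sum fun y'' _ => ?_)))
      · have h := le_cubeSup (dir0 P, dir0 P) (dDD P a 0 P.K fun ν => pullV P (Tt ν)) (lam, μ) hx
        rwa [dDD_eq] at h
      · have h := le_cubeSup (dir0 P, dir0 P) (dKD P a 0 P.K (pc P a (tDiv P fun ν => pullV P (Tt ν)) y'')) (lam, μ) hx
        rwa [dKD_eq] at h

/-- **`Display133.h2`: (1.132) for the Hölder entry (1.113)** — `‖ζ∇G∇*T‖_α ≤ ‖(κζ)∇G₀∇*T‖_α + Σ_{y″} ‖(κζ)∇G₀(piece)‖_α`: every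
admissible pair of r19's seminorm is a pair of bridged tower sites at the same distance (`holderT_le_of_pairs`), the quotient of the
sum is bounded by the Hölder norm of the sum (`abs_sub_le_holN_mul`), which is subadditive (`holN_add_le`, `holN_sum_le`).
[cite: Balaban1984PropagatorsI, (1.132) p.39, (1.113) p.36, (1.109) p.35] -/
theorem h2_132 (ha : 0 < a) (J : LocR (nP P) (MP P)) (α : ℝ) (ζ : Tor (fine (nP P) (MP P)) → ℝ) :
    (latticeSettingP12Rt (nP P) (MP P) a P.K).h2 J α ζ ≤
      (g0Diag P a 0 P.K).h2 (ιR P J) α (κR P ζ) +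
        ∑ y'' : Tor (MP P), (g0Diag P a 0 P.K).h1 (piece132 P a 2 J y'') α (κR P ζ) := by
  have hR0 : 0 ≤ (g0Diag P a 0 P.K).h2 (ιR P J) α (κR P ζ) +
      ∑ y'' : Tor (MP P), (g0Diag P a 0 P.K).h1 (piece132 P a 2 J y'') α (κR P ζ) :=
    add_nonneg (h2_diag_nonneg P _ α _) (Finset.sum_nonneg fun y'' _ => h1_diag_nonneg P _ α _)
  cases J with
  | vec Jv =>
      show (0 : ℝ) ≤ _
      exact hR0
  | ten2 T2 =>
      show (0 : ℝ) ≤ _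
      exact hR0
  | ten Tt =>
      show holderT (nP P) (MP P) α (smulT (nP P) (MP P) ζ (grad (nP P) (MP P)
          ((DeltaA (nP P) (MP P) a)⁻¹ *ᵥ divT (nP P) (MP P) fun ν b => ((Tt ν b : ℝ) : ℂ)))) ≤ _
      rw [divT_cplx_eq_embA P Tt]
      refine holderT_le_of_pairs P _ hR0 fun lam μ x x' hne hd1 => ?_
      have hpt : ∀ z, tD P lam (tG0 P a (tDiv P fun ν => pullV P (Tt ν))) μ z
          = dDD P a 0 P.K (fun ν => pullV P (Tt ν)) (lam, μ) z := fun z => (dDD_eq P _ lam μ z).symm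
      have hpt' : ∀ y'' z, tD P lam (tG0 P a (pc P a (tDiv P fun ν => pullV P (Tt ν)) y'')) μ z
          = dKD P a 0 P.K (pc P a (tDiv P fun ν => pullV P (Tt ν)) y'') (lam, μ) z :=
        fun y'' z => (dKD_eq P _ lam μ z).symm
      have hg : ∀ z : Site P 0,
          smulT (nP P) (MP P) ζ (grad (nP P) (MP P) ((DeltaA (nP P) (MP P) a)⁻¹ *ᵥ
              embA P (tDiv P fun ν => pullV P (Tt ν)))) lam (eFine P z, μ)
            = ((ζ (eFine P z) * dDD P a 0 P.K (fun ν => pullV P (Tt ν)) (lam, μ) z +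
                ∑ y'' : Tor (MP P), ζ (eFine P z) *
                  dKD P a 0 P.K (pc P a (tDiv P fun ν => pullV P (Tt ν)) y'') (lam, μ) z : ℝ) : ℂ) := by
        intro z
        show (ζ (eFine P z) : ℂ) * grad (nP P) (MP P) ((DeltaA (nP P) (MP P) a)⁻¹ *ᵥ
            embA P (tDiv P fun ν => pullV P (Tt ν))) lam (eFine P z, μ) = _
        rw [grad_G_embA_apply P ha, ← Complex.ofReal_mul, mul_add, Finset.mul_sum]
        simp only [hpt, hpt']
      rw [hg, hg, ← Complex.ofReal_sub, Complex.norm_real, Real.norm_eq_abs]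
      refine (B5GpSettingTorus.abs_sub_le_holN_mul P.K α
        (fun z => ζ (eFine P z) * dDD P a 0 P.K (fun ν => pullV P (Tt ν)) (lam, μ) z +
          ∑ y'' : Tor (MP P), ζ (eFine P z) * dKD P a 0 P.K (pc P a (tDiv P fun ν => pullV P (Tt ν)) y'') (lam, μ) z)
        hne hd1).trans (mul_le_mul_of_nonneg_right ?_ (Real.rpow_nonneg (distX_nonneg P P.K x x') α))
      refine (holN_add_le P.K α _ _).trans (add_le_add ?_ ((holN_sum_le P.K α _ _).trans
        (Finset.sum_le_sum fun y'' _ => ?_)))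
      · exact le_holG P.K α (dir0 P, dir0 P) (fun p x => κR P ζ x * dDD P a 0 P.K (fun ν => pullV P (Tt ν)) p x) (lam, μ)
      · exact le_holG P.K α (dir0 P, dir0 P)
          (fun p x => κR P ζ x * dKD P a 0 P.K (pc P a (tDiv P fun ν => pullV P (Tt ν)) y'') p x) (lam, μ)

/-- **`Display133.h1`: (1.132) for the Hölder entries (1.111)** (exponents `α ≤ 1`; the truncated entry is `0` beyond).  Vector
sources, `‖ζ∇GJ‖_α`: as `h2` with `A = J` (subadditivity only; the mean-value term is dropped, it is `≥ 0`).  Tensor sources,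
`‖ζG∇*T‖_α ≤ ‖(κζ)G₀∇*T‖_α + Σ_{y″} ‖(κζ)·G₀(piece_{y″})‖_α` and, piece by piece, p37's PRODUCT RULE WITH THE LATTICE MEAN-VALUE STEP
`B5Display133G0Torus.holN_cut_mul_le`: `‖(κζ)u‖_α ≤ (‖κζ‖_α + |κζ|)(M₀ + d·M₁)` with `M₀`, `M₁` the sums over the radius-6 ball of
`y` of the cube sups of `|G₀(piece)|`, `|∇G₀(piece)|` (a fine point within 3 of `y` lies in a block of the ball, `proj_mem_nbrOf`),
`‖κζ‖_α + |κζ| ≤ ‖ζ‖_α + |ζ|` (`cutHV_κR_le`) and `M₀ + d·M₁ ≤ (d + 1)(M₀ + M₁) ≤ Dh(M₀ + M₁)`.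
[cite: Balaban1984PropagatorsI, (1.132) p.39, (1.111) p.35, (1.109) p.35] -/
theorem h1_132 (ha : 0 < a) {Dh : ℝ} (hDh : (P.d : ℝ) + 1 ≤ Dh) (J : LocR (nP P) (MP P)) (α : ℝ)
    (ζ : Tor (fine (nP P) (MP P)) → ℝ) (y : Tor (MP P)) (hζ : cutInL (nP P) (MP P) ζ y) :
    (latticeSettingP12Rt (nP P) (MP P) a P.K).h1 J α ζ ≤
      (g0Diag P a 0 P.K).h1 (ιR P J) α (κR P ζ) +
        ∑ y'' : Tor (MP P), ((g0Diag P a 0 P.K).h1 (piece132 P a 0 J y'') α (κR P ζ) +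
          Dh * (latticeSettingP12Rt (nP P) (MP P) a P.K).cutH α ζ *
            ∑ w ∈ B5UnitBallCard.ball (MP P) y 6,
              ((g0Diag P a 0 P.K).e 0 (piece132 P a 2 J y'') (σR P w) +
                (g0Diag P a 0 P.K).e 1 (piece132 P a 2 J y'') (σR P w))) := by
  have hDh0 : 0 ≤ Dh := le_trans (by positivity) hDh
  have hD : ∀ y'' : Tor (MP P), 0 ≤ Dh * (latticeSettingP12Rt (nP P) (MP P) a P.K).cutH α ζ *
      ∑ w ∈ B5UnitBallCard.ball (MP P) y 6,
        ((g0Diag P a 0 P.K).e 0 (piece132 P a 2 J y'') (σR P w) + (g0Diag P a 0 P.K).e 1 (piece132 P a 2 J y'') (σR P w)) :=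
    fun y'' => mul_nonneg (mul_nonneg hDh0 (cutHL_nonneg α ζ))
      (Finset.sum_nonneg fun w _ => add_nonneg (e_diag_nonneg P 0 _ _) (e_diag_nonneg P 1 _ _))
  have hR0 : 0 ≤ (g0Diag P a 0 P.K).h1 (ιR P J) α (κR P ζ) +
      ∑ y'' : Tor (MP P), ((g0Diag P a 0 P.K).h1 (piece132 P a 0 J y'') α (κR P ζ) +
        Dh * (latticeSettingP12Rt (nP P) (MP P) a P.K).cutH α ζ *
          ∑ w ∈ B5UnitBallCard.ball (MP P) y 6,
            ((g0Diag P a 0 P.K).e 0 (piece132 P a 2 J y'') (σR P w) +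
              (g0Diag P a 0 P.K).e 1 (piece132 P a 2 J y'') (σR P w))) :=
    add_nonneg (h1_diag_nonneg P _ α _)
      (Finset.sum_nonneg fun y'' _ => add_nonneg (h1_diag_nonneg P _ α _) (hD y''))
  rw [h1_Rt]
  split_ifs with hα
  swap
  · exact hR0
  cases J with
  | ten2 T2 =>
      show (0 : ℝ) ≤ _
      exact hR0
  | vec Jv =>
      -- ‖ζ∇GJ‖_α: subadditivity only
      show holderT (nP P) (MP P) α (smulT (nP P) (MP P) ζ (grad (nP P) (MP P)
          ((DeltaA (nP P) (MP P) a)⁻¹ *ᵥ fun b => ((Jv b : ℝ) : ℂ)))) ≤ _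
      rw [cplxVec_eq_embA P Jv]
      refine holderT_le_of_pairs P _ hR0 fun lam μ x x' hne hd1 => ?_
      have hpt : ∀ z, tD P lam (tG0 P a (pullV P Jv)) μ z = dKD P a 0 P.K (pullV P Jv) (lam, μ) z :=
        fun z => (dKD_eq P _ lam μ z).symm
      have hpt' : ∀ y'' z, tD P lam (tG0 P a (pc P a (pullV P Jv) y'')) μ z
          = dKD P a 0 P.K (pc P a (pullV P Jv) y'') (lam, μ) z := fun y'' z => (dKD_eq P _ lam μ z).symm
      have hg : ∀ z : Site P 0,
          smulT (nP P) (MP P) ζ (grad (nP P) (MP P) ((DeltaA (nP P) (MP P) a)⁻¹ *ᵥ embA P (pullV P Jv))) lam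
              (eFine P z, μ)
            = ((ζ (eFine P z) * dKD P a 0 P.K (pullV P Jv) (lam, μ) z +
                ∑ y'' : Tor (MP P), ζ (eFine P z) * dKD P a 0 P.K (pc P a (pullV P Jv) y'') (lam, μ) z : ℝ) : ℂ) := by
        intro z
        show (ζ (eFine P z) : ℂ) * grad (nP P) (MP P) ((DeltaA (nP P) (MP P) a)⁻¹ *ᵥ embA P (pullV P Jv)) lam
            (eFine P z, μ) = _
        rw [grad_G_embA_apply P ha, ← Complex.ofReal_mul, mul_add, Finset.mul_sum]
        simp only [hpt, hpt']
      rw [hg, hg, ← Complex.ofReal_sub, Complex.norm_real, Real.norm_eq_abs]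
      refine (B5GpSettingTorus.abs_sub_le_holN_mul P.K α
        (fun z => ζ (eFine P z) * dKD P a 0 P.K (pullV P Jv) (lam, μ) z +
          ∑ y'' : Tor (MP P), ζ (eFine P z) * dKD P a 0 P.K (pc P a (pullV P Jv) y'') (lam, μ) z)
        hne hd1).trans (mul_le_mul_of_nonneg_right ?_ (Real.rpow_nonneg (distX_nonneg P P.K x x') α))
      refine (holN_add_le P.K α _ _).trans (add_le_add ?_ ((holN_sum_le P.K α _ _).trans
        (Finset.sum_le_sum fun y'' _ => ?_)))
      · exact le_holG P.K α (dir0 P, dir0 P) (fun p x => κR P ζ x * dKD P a 0 P.K (pullV P Jv) p x) (lam, μ)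
      · exact (le_holG P.K α (dir0 P, dir0 P)
          (fun p x => κR P ζ x * dKD P a 0 P.K (pc P a (pullV P Jv) y'') p x) (lam, μ)).trans
            (le_add_of_nonneg_right (hD y''))
  | ten Tt =>
      -- ‖ζG∇*T‖_α: subadditivity, then the product rule with the mean-value step on every piece
      show holderV (nP P) (MP P) α (smulV (nP P) (MP P) ζ
          ((DeltaA (nP P) (MP P) a)⁻¹ *ᵥ divT (nP P) (MP P) fun ν b => ((Tt ν b : ℝ) : ℂ))) ≤ _
      rw [divT_cplx_eq_embA P Tt]
      refine holderV_le_of_pairs P _ hR0 fun μ x x' hne hd1 => ?_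
      have hpt : ∀ z, tG0 P a (tDiv P fun ν => pullV P (Tt ν)) μ z = dDiv P a 0 P.K (fun ν => pullV P (Tt ν)) μ z :=
        fun z => (dDiv_eq P _ μ z).symm
      have hg : ∀ z : Site P 0,
          smulV (nP P) (MP P) ζ ((DeltaA (nP P) (MP P) a)⁻¹ *ᵥ embA P (tDiv P fun ν => pullV P (Tt ν))) (eFine P z, μ)
            = ((ζ (eFine P z) * dDiv P a 0 P.K (fun ν => pullV P (Tt ν)) μ z +
                ∑ y'' : Tor (MP P), ζ (eFine P z) *
                  dK0 P a 0 P.K (pc P a (tDiv P fun ν => pullV P (Tt ν)) y'') μ z : ℝ) : ℂ) := by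
        intro z
        show (ζ (eFine P z) : ℂ) * ((DeltaA (nP P) (MP P) a)⁻¹ *ᵥ embA P (tDiv P fun ν => pullV P (Tt ν))) (eFine P z, μ) = _
        rw [G_embA_apply P ha, ← Complex.ofReal_mul, mul_add, Finset.mul_sum]
        simp only [hpt]
        rfl
      rw [hg, hg, ← Complex.ofReal_sub, Complex.norm_real, Real.norm_eq_abs]
      refine (B5GpSettingTorus.abs_sub_le_holN_mul P.K α
        (fun z => ζ (eFine P z) * dDiv P a 0 P.K (fun ν => pullV P (Tt ν)) μ z +
          ∑ y'' : Tor (MP P), ζ (eFine P z) * dK0 P a 0 P.K (pc P a (tDiv P fun ν => pullV P (Tt ν)) y'') μ z)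
        hne hd1).trans (mul_le_mul_of_nonneg_right ?_ (Real.rpow_nonneg (distX_nonneg P P.K x x') α))
      refine (holN_add_le P.K α _ _).trans (add_le_add ?_ ((holN_sum_le P.K α _ _).trans
        (Finset.sum_le_sum fun y'' _ => ?_)))
      · exact le_holG P.K α (dir0 P) (fun ν x => κR P ζ x * dDiv P a 0 P.K (fun ν => pullV P (Tt ν)) ν x) μ
      · refine le_trans ?_ (le_add_of_nonneg_left (h1_diag_nonneg P _ α _))
        set B := pc P a (tDiv P fun ν => pullV P (Tt ν)) y'' with hB
        set M₀ := ∑ w ∈ B5UnitBallCard.ball (MP P) y 6, (g0Diag P a 0 P.K).e 0 (piece132 P a 2 (LocR.ten Tt) y'') (σR P w)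
          with hM₀
        set M₁ := ∑ w ∈ B5UnitBallCard.ball (MP P) y 6, (g0Diag P a 0 P.K).e 1 (piece132 P a 2 (LocR.ten Tt) y'') (σR P w)
          with hM₁
        have hM₀0 : 0 ≤ M₀ := Finset.sum_nonneg fun w _ => e_diag_nonneg P 0 _ _
        have hM₁0 : 0 ≤ M₁ := Finset.sum_nonneg fun w _ => e_diag_nonneg P 1 _ _
        have hζ' : ∀ z, κR P ζ z ≠ 0 → inCube P P.K z (σR P y) := cutIn_κR P ζ y hζ
        have hk : P.K ≤ P.m + P.K := Nat.le_add_left _ _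
        have h0 : ∀ w', T P 0 w' (B5Ineq137Torus.fine P P.K (σR P y)) ≤ 3 * (P.L : ℝ) ^ P.K →
            |dK0 P a 0 P.K B μ w'| ≤ M₀ := by
          intro w' hw'
          have hmem := eUnit_mem_ball P (proj_mem_nbrOf hk hw')
          refine le_trans ?_ (Finset.single_le_sum
            (f := fun w => (g0Diag P a 0 P.K).e 0 (piece132 P a 2 (LocR.ten Tt) y'') (σR P w))
            (fun w _ => e_diag_nonneg P 0 _ _) hmem)
          show |dK0 P a 0 P.K B μ w'| ≤ cubeSup P P.K (σR P (eUnit P (Site.proj P.K P.K w'))) (dir0 P) (dK0 P a 0 P.K B)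
          rw [σR_eUnit]
          exact le_cubeSup (dir0 P) (dK0 P a 0 P.K B) μ (inCube_proj hk w')
        have h1' : ∀ w' μ', T P 0 w' (B5Ineq137Torus.fine P P.K (σR P y)) ≤ 3 * (P.L : ℝ) ^ P.K →
            |(dEta P P.K μ' *ᵥ dK0 P a 0 P.K B μ) w'| ≤ M₁ := by
          intro w' μ' hw'
          have hmem := eUnit_mem_ball P (proj_mem_nbrOf hk hw')
          have hval : (dEta P P.K μ' *ᵥ dK0 P a 0 P.K B μ) w' = dKD P a 0 P.K B (μ', μ) w' := by
            rw [dEta_top]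
            exact (dKD_eq P B μ' μ w').symm
          rw [hval]
          refine le_trans ?_ (Finset.single_le_sum
            (f := fun w => (g0Diag P a 0 P.K).e 1 (piece132 P a 2 (LocR.ten Tt) y'') (σR P w))
            (fun w _ => e_diag_nonneg P 1 _ _) hmem)
          show |dKD P a 0 P.K B (μ', μ) w'| ≤
            cubeSup P P.K (σR P (eUnit P (Site.proj P.K P.K w'))) (dir0 P, dir0 P) (dKD P a 0 P.K B)
          rw [σR_eUnit]
          exact le_cubeSup (dir0 P, dir0 P) (dKD P a 0 P.K B) (μ', μ) (inCube_proj hk w')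
        have hmv := holN_cut_mul_le (k := P.K) hα (κR P ζ) (dK0 P a 0 P.K B μ) hζ' hM₀0 hM₁0 h0 h1'
        refine hmv.trans ?_
        rw [Finset.sum_add_distrib, ← hM₀, ← hM₁]
        have hc0 : (0 : ℝ) ≤ P.d := Nat.cast_nonneg _
        calc cutHV P P.K α (κR P ζ) * (M₀ + P.d * M₁)
            ≤ cutHL (nP P) (MP P) α ζ * ((P.d + 1) * (M₀ + M₁)) := by
              refine mul_le_mul (cutHV_κR_le P α ζ) ?_ (add_nonneg hM₀0 (mul_nonneg hc0 hM₁0)) (cutHL_nonneg α ζ)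
              nlinarith
          _ ≤ cutHL (nP P) (MP P) α ζ * (Dh * (M₀ + M₁)) :=
              mul_le_mul_of_nonneg_left (mul_le_mul_of_nonneg_right hDh (add_nonneg hM₀0 hM₁0)) (cutHL_nonneg α ζ)
          _ = Dh * cutHL (nP P) (MP P) α ζ * (M₀ + M₁) := by ring

/-- **THE LOCATED DISPLAY OF THE (1.132)-TRANSFER, PROVED** for the carrier of record and every `Dh ≥ d + 1`: the identity
`G = G₀ + G₀∂P∂*G` entrywise across the two presentations — every sup / Hölder entry of Prop. 1.2 for G at `(J, y, ζ)` is ≤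
the same entry of the diagonal G₀ at `ι J` plus the G₀-entries of the cube pieces `1_{Δ(y″)}∂P∂*G^{(p)}J`.
[cite: Balaban1984PropagatorsI, (1.132) p.39 («implies immediately … Proposition 1.2 for G»), (1.110)–(1.113) pp.35–36] -/
theorem display132 (ha : 0 < a) {Dh : ℝ} (hDh : (P.d : ℝ) + 1 ≤ Dh) :
    B5Transfer133.Display133 (carrier132 P a) Dh where
  sup := sup132 P ha
  h1 := fun J α ζ y hζ => h1_132 P ha hDh J α ζ y hζ
  Dh_nonneg := le_trans (by positivity) hDh
  e4 := e4_132 P ha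
  h2 := fun J α ζ _ _ => h2_132 P ha J α ζ

end Display

end

end Literature.MathematicalPhysics.QuantumFieldTheory.Balaban1983to89.B5Display132Lattice
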